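import Mathlib
import Literature.Computability.AlgebraicComplexity.BorderApolarityTests
import Literature.Computability.AlgebraicComplexity.MatrixMultiplicationExponent
import Summits.MatrixMultiplication.MatrixMultiplication.Theorems.FidelityWitnessesSevenEighthsLawStubSliceElimination

/-!
# `FidelityWitnesses.SevenEighthsLaw`, line `sharp-grassmann-apolarity`: `stub_outputElimination` (G2)

Support file for crux item `stmt-MatrixMultiplication-4959`
(`Summit.MatrixMultiplication.MatrixMultiplication.Theses.FidelityWitnesses.SevenEighthsLaw`, `M(2,6) = 7`:
`|⟨S, ⟨2,2,2⟩⟩|² ≤ 7 · ‖S‖²` for every rank-`≤ 6` tensor `S` in the `2 × 2` format), line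
`sharp-grassmann-apolarity`, registered stub `stub_outputElimination` — EXACT ELIMINATION OF THE OUTPUT
FACTOR (projection bound).

Slots: `S a b c` with `a = (κ,ν)` the output slot, `b = (κ,μ)`, `c = (μ,ν)`, all in `P2 = Fin 2 × Fin 2`;
`matMulTensor ℂ 2 2 2 a b c = [a.1 = b.1 ∧ b.2 = c.1 ∧ a.2 = c.2]`.  For an orthonormal `10`-frame `Y` of
bilinear forms on `P2 × P2` (for `⟨f, g⟩ = Σ conj f · g`) its F-height is
`h(Y) = ½ Σ_r Σ_{κν} |Σ_μ Y_r ((κ,μ),(μ,ν))|²`.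

* `stub_outputElimination` — if every `Y_r` annihilates every output slice `S(a,·,·)`
  (`Y_r ∈ annSub S`), then `|Σ S · ⟨2,2,2⟩|² ≤ 2 (4 − h(Y)) ‖S‖²`.

Proof (Hermitian geometry in `EuclideanSpace ℂ (P2 × P2)`): put `z_r := conj ∘ Y_r` (orthonormal),
`x_a := S(a,·,·)`, `t_a := ⟨2,2,2⟩(a,·,·)` (real `0/1`, `‖t_a‖² = 2`).  Annihilation reads `⟪z_r, x_a⟫ = 0`;
the overlap is `Σ_a ⟪t_a, x_a⟫`.  With `t'_a := t_a − Σ_r ⟪z_r, t_a⟫ z_r` one has `⟪t'_a, x_a⟫ = ⟪t_a, x_a⟫`,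
`‖t'_a‖² = 2 − Σ_r |⟪z_r, t_a⟫|²` (`orthonormal_norm_sq_sub_sum_inner_smul`, the identity behind Bessel's
inequality) and `⟪z_r, t_a⟫ = Σ_μ Y_r ((a.1,μ),(μ,a.2))` (`slice_sum_matMulTensor`), so
`Σ_a ‖t'_a‖² = 8 − 2 h(Y)`; finally `|⟪t'_a, x_a⟫| ≤ ‖t'_a‖ ‖x_a‖` and the real Cauchy–Schwarz inequality
over `a` give `|Σ_a ⟪t_a, x_a⟫|² ≤ (Σ_a ‖t'_a‖²)(Σ_a ‖x_a‖²) = 2 (4 − h(Y)) ‖S‖²`.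
Mathlib only, plus the tree definitions `annSub`, `matMulTensor` and the landed helper
`slice_sum_matMulTensor`.
-/

set_option linter.dupNamespace false

namespace Summit.MatrixMultiplication.MatrixMultiplication.Theorems.SevenEighthsLaw

open scoped BigOperators ComplexConjugate InnerProductSpace
open Literature.Computability.AlgebraicComplexity

/-! ## The identity behind Bessel's inequality -/

/-- Pythagoras for an orthonormal family `v`: removing from `x` its components along the `v i`,
`i ∈ s`, lowers `‖x‖²` by exactly `Σ_{i ∈ s} |⟪v i, x⟫|²` (the identity inside Mathlib's proof of
`Orthonormal.sum_inner_products_le`). -/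
theorem orthonormal_norm_sq_sub_sum_inner_smul {𝕜 E ι : Type*} [RCLike 𝕜]
    [SeminormedAddCommGroup E] [InnerProductSpace 𝕜 E] {v : ι → E} (hv : Orthonormal 𝕜 v) (x : E)
    (s : Finset ι) :
    ‖x - ∑ i ∈ s, ⟪v i, x⟫_𝕜 • v i‖ ^ 2 = ‖x‖ ^ 2 - ∑ i ∈ s, ‖⟪v i, x⟫_𝕜‖ ^ 2 := by
  -- adapted from Mathlib's `Orthonormal.sum_inner_products_le`
  have h₂ : (∑ i ∈ s, ∑ j ∈ s, ⟪v i, x⟫_𝕜 * ⟪x, v j⟫_𝕜 * ⟪v j, v i⟫_𝕜)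
      = (∑ k ∈ s, ⟪v k, x⟫_𝕜 * ⟪x, v k⟫_𝕜 : 𝕜) := by
    classical exact hv.inner_left_right_finset
  have h₃ : ∀ z : 𝕜, RCLike.re (z * conj z) = ‖z‖ ^ 2 := by
    intro z
    simp only [RCLike.mul_conj]
    norm_cast
  rw [@norm_sub_sq 𝕜, sub_add]
  simp only [@InnerProductSpace.norm_sq_eq_re_inner 𝕜 E, inner_sum, sum_inner]
  simp only [inner_smul_right, two_mul, inner_smul_left, inner_conj_symm, ← mul_assoc, h₂,
    add_sub_cancel_right, sub_right_inj]
  simp only [map_sum, ← inner_conj_symm x, ← h₃]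

/-! ## The stub -/

/-- **Stub G2 — exact elimination of the output factor (projection bound)** of line
`sharp-grassmann-apolarity` for `SevenEighthsLaw`.  If an orthonormal `10`-frame `Y` of bilinear forms
(unit norms `Σ_p |Y_r p|² = 1`, pairwise `Σ_p conj (Y_r p) Y_{r'} p = 0`) annihilates every output slice of
`S` (`Y_r ∈ annSub S`, i.e. `Σ_{b,c} Y_r (b,c) S(a,b,c) = 0` for all `a`), then
`|Σ_{a,b,c} S(a,b,c) ⟨2,2,2⟩(a,b,c)|² ≤ 2 · (4 − ½ Σ_r Σ_{κν} |Σ_μ Y_r ((κ,μ),(μ,ν))|²) · Σ |S|²`.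
Proof: `z_r := conj ∘ Y_r` is orthonormal in `EuclideanSpace ℂ (P2 × P2)` and orthogonal to the slices
`x_a := S(a,·,·)`; with `t_a := ⟨2,2,2⟩(a,·,·)` and `t'_a := t_a − Σ_r ⟪z_r,t_a⟫ z_r` the overlap is
`Σ_a ⟪t'_a, x_a⟫`, `‖t'_a‖² = 2 − Σ_r |Σ_μ Y_r ((a.1,μ),(μ,a.2))|²`, and Cauchy–Schwarz over `a`. -/
theorem stub_outputElimination :
    ∀ (S : (Fin 2 × Fin 2) → (Fin 2 × Fin 2) → (Fin 2 × Fin 2) → ℂ)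
      (Y : Fin 10 → ((Fin 2 × Fin 2) × (Fin 2 × Fin 2) → ℂ)),
      ((∀ r, ∑ p, ‖Y r p‖ ^ 2 = 1) ∧ (∀ r r', r ≠ r' → ∑ p, conj (Y r p) * Y r' p = 0)) →
      (∀ r, Y r ∈ annSub S) →
      ‖∑ a, ∑ b, ∑ c, S a b c * matMulTensor ℂ 2 2 2 a b c‖ ^ 2
        ≤ 2 * (4 - (∑ r, ∑ κ : Fin 2, ∑ ν : Fin 2, ‖∑ μ : Fin 2, Y r ((κ, μ), (μ, ν))‖ ^ 2) / 2) *
          ∑ a, ∑ b, ∑ c, ‖S a b c‖ ^ 2 := by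
  classical
  rintro S Y ⟨hY1, hY2⟩ hann
  -- the players, as vectors of `EuclideanSpace ℂ (P2 × P2)`
  let z : Fin 10 → EuclideanSpace ℂ ((Fin 2 × Fin 2) × (Fin 2 × Fin 2)) :=
    fun r => WithLp.toLp 2 (fun p => conj (Y r p))
  let x : (Fin 2 × Fin 2) → EuclideanSpace ℂ ((Fin 2 × Fin 2) × (Fin 2 × Fin 2)) :=
    fun a => WithLp.toLp 2 (fun p => S a p.1 p.2)
  let t : (Fin 2 × Fin 2) → EuclideanSpace ℂ ((Fin 2 × Fin 2) × (Fin 2 × Fin 2)) :=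
    fun a => WithLp.toLp 2 (fun p => matMulTensor ℂ 2 2 2 a p.1 p.2)
  -- `z` is orthonormal
  have hz : Orthonormal ℂ z := by
    rw [orthonormal_iff_ite]
    intro r r'
    have key : ⟪z r, z r'⟫_ℂ = conj (∑ p, conj (Y r p) * Y r' p) := by
      simp only [z, PiLp.inner_apply, RCLike.inner_apply', map_sum, map_mul, Complex.conj_conj]
    rw [key]
    split_ifs with h
    · subst h
      have h1 : (∑ p, conj (Y r p) * Y r p) = 1 := by
        simp_rw [Complex.conj_mul']
        exact_mod_cast hY1 r
      rw [h1, map_one]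
    · rw [hY2 r r' h, map_zero]
  -- annihilation: `z_r ⟂ x_a`
  have hzx : ∀ r a, ⟪z r, x a⟫_ℂ = 0 := by
    intro r a
    have h := (mem_annSub.mp (hann r)) a
    rw [← h]
    simp only [z, x, PiLp.inner_apply, RCLike.inner_apply', Complex.conj_conj, Fintype.sum_prod_type]
  -- the slices of `⟨2,2,2⟩` are real
  have hTreal : ∀ a b c : Fin 2 × Fin 2,
      conj (matMulTensor ℂ 2 2 2 a b c) = matMulTensor ℂ 2 2 2 a b c := by
    intro a b c
    unfold matMulTensor
    split_ifs <;> simp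
  -- the overlap, slice by slice
  have htx : ∀ a, ⟪t a, x a⟫_ℂ = ∑ b, ∑ c, S a b c * matMulTensor ℂ 2 2 2 a b c := by
    intro a
    have h' : ∑ b, ∑ c, S a b c * matMulTensor ℂ 2 2 2 a b c
        = ∑ b, ∑ c, conj (matMulTensor ℂ 2 2 2 a b c) * S a b c :=
      Finset.sum_congr rfl fun b _ => Finset.sum_congr rfl fun c _ => by rw [hTreal, mul_comm]
    rw [h']
    simp only [t, x, PiLp.inner_apply, RCLike.inner_apply', Fintype.sum_prod_type]
  -- the frame coefficients of the slices of `⟨2,2,2⟩`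
  have hzt : ∀ r a, ⟪z r, t a⟫_ℂ = ∑ μ : Fin 2, Y r ((a.1, μ), (μ, a.2)) := by
    intro r a
    rw [← slice_sum_matMulTensor (fun b c => Y r (b, c)) a]
    simp only [z, t, PiLp.inner_apply, RCLike.inner_apply', Complex.conj_conj, Fintype.sum_prod_type]
  -- norms
  have ht2 : ∀ a, ‖t a‖ ^ 2 = 2 := by
    intro a
    rw [EuclideanSpace.norm_sq_eq]
    obtain ⟨a1, a2⟩ := a
    fin_cases a1 <;> fin_cases a2 <;>
      simp [t, Fintype.sum_prod_type, Fin.sum_univ_two, matMulTensor] <;> norm_num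
  have hx2 : ∀ a, ‖x a‖ ^ 2 = ∑ b, ∑ c, ‖S a b c‖ ^ 2 := by
    intro a
    rw [EuclideanSpace.norm_sq_eq]
    simp only [x, Fintype.sum_prod_type]
  -- the projected slices `t'_a := t_a - Σ_r ⟪z_r, t_a⟫ z_r`
  let t' : (Fin 2 × Fin 2) → EuclideanSpace ℂ ((Fin 2 × Fin 2) × (Fin 2 × Fin 2)) :=
    fun a => t a - ∑ r, ⟪z r, t a⟫_ℂ • z r
  have ht'x : ∀ a, ⟪t' a, x a⟫_ℂ = ⟪t a, x a⟫_ℂ := by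
    intro a
    simp only [t', inner_sub_left, sum_inner, inner_smul_left, hzx, mul_zero,
      Finset.sum_const_zero, sub_zero]
  have ht'2 : ∀ a, ‖t' a‖ ^ 2 = 2 - ∑ r, ‖∑ μ : Fin 2, Y r ((a.1, μ), (μ, a.2))‖ ^ 2 := by
    intro a
    show ‖t a - ∑ r, ⟪z r, t a⟫_ℂ • z r‖ ^ 2 = _
    rw [orthonormal_norm_sq_sub_sum_inner_smul hz (t a) Finset.univ, ht2 a]
    simp only [hzt]
  have hsum : ∑ a, ‖t' a‖ ^ 2
      = 8 - ∑ r, ∑ κ : Fin 2, ∑ ν : Fin 2, ‖∑ μ : Fin 2, Y r ((κ, μ), (μ, ν))‖ ^ 2 := by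
    simp only [ht'2, Finset.sum_sub_distrib, Finset.sum_const, Finset.card_univ, Fintype.card_prod,
      Fintype.card_fin, nsmul_eq_mul]
    rw [Finset.sum_comm]
    simp only [Fintype.sum_prod_type]
    norm_num
  -- the overlap through the projected slices
  have hover : ∑ a, ∑ b, ∑ c, S a b c * matMulTensor ℂ 2 2 2 a b c = ∑ a, ⟪t' a, x a⟫_ℂ :=
    Finset.sum_congr rfl fun a _ => by rw [ht'x, htx]
  -- Cauchy–Schwarz, twice
  have hCS1 : ‖∑ a, ⟪t' a, x a⟫_ℂ‖ ≤ ∑ a, ‖t' a‖ * ‖x a‖ :=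
    (norm_sum_le _ _).trans (Finset.sum_le_sum fun a _ => norm_inner_le_norm _ _)
  calc ‖∑ a, ∑ b, ∑ c, S a b c * matMulTensor ℂ 2 2 2 a b c‖ ^ 2
      = ‖∑ a, ⟪t' a, x a⟫_ℂ‖ ^ 2 := by rw [hover]
    _ ≤ (∑ a, ‖t' a‖ * ‖x a‖) ^ 2 := pow_le_pow_left₀ (norm_nonneg _) hCS1 2
    _ ≤ (∑ a, ‖t' a‖ ^ 2) * ∑ a, ‖x a‖ ^ 2 := Finset.sum_mul_sq_le_sq_mul_sq _ _ _
    _ = 2 * (4 - (∑ r, ∑ κ : Fin 2, ∑ ν : Fin 2, ‖∑ μ : Fin 2, Y r ((κ, μ), (μ, ν))‖ ^ 2) / 2) *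
          ∑ a, ∑ b, ∑ c, ‖S a b c‖ ^ 2 := by
        rw [hsum]
        simp only [hx2]
        ring

end Summit.MatrixMultiplication.MatrixMultiplication.Theorems.SevenEighthsLaw
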